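import Summits.Ventures.PercRepro.RankLevelSetRuleQNineCertDefs
/-!
# PercRepro — THE PARTIAL PRODUCTS OF THE CERTIFICATES OF THE FAMILY `k = 9` (p4, gen 25; C-044; paper §13.7): the four identities
`N^h·na + D^h·nb = P^h` (`h = A, B`; the lower and the upper convergent), each one `ring` with the short half-factor on the left.
No `sorry`; axioms standard.
-/

namespace PercRepro

set_option maxHeartbeats 6400000 in
set_option maxRecDepth 16384 in
/-- The partial product identity A of the lower certificate: `N_15^A·na + D_15^A·nb` in `(q, m)` — the short half-factor
(50 + 54 monomials) on the left of each product. -/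
lemma nine_lower_prodA (q m : ℚ) :
    cfFifteenNA q m * naNine q m + cfFifteenDA q m * nbNine q m = pLowerNineA q m := by
  unfold cfFifteenNA cfFifteenDA naNine nbNine pLowerNineA; ring

set_option maxHeartbeats 6400000 in
set_option maxRecDepth 16384 in
/-- The partial product identity B of the lower certificate: `N_15^B·na + D_15^B·nb` in `(q, m)` — the short half-factor
(50 + 54 monomials) on the left of each product. -/
lemma nine_lower_prodB (q m : ℚ) :
    cfFifteenNB q m * naNine q m + cfFifteenDB q m * nbNine q m = pLowerNineB q m := by
  unfold cfFifteenNB cfFifteenDB naNine nbNine pLowerNineB; ring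

set_option maxHeartbeats 6400000 in
set_option maxRecDepth 16384 in
/-- The partial product identity A of the upper certificate: `N_13^A·na + D_13^A·nb` in `(q, m)` — the short half-factor
(38 + 42 monomials) on the left of each product. -/
lemma nine_upper_prodA (q m : ℚ) :
    cfThirteenNA q m * naNine q m + cfThirteenDA q m * nbNine q m = pUpperNineA q m := by
  unfold cfThirteenNA cfThirteenDA naNine nbNine pUpperNineA; ring

set_option maxHeartbeats 6400000 in
set_option maxRecDepth 16384 in
/-- The partial product identity B of the upper certificate: `N_13^B·na + D_13^B·nb` in `(q, m)` — the short half-factor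
(39 + 42 monomials) on the left of each product. -/
lemma nine_upper_prodB (q m : ℚ) :
    cfThirteenNB q m * naNine q m + cfThirteenDB q m * nbNine q m = pUpperNineB q m := by
  unfold cfThirteenNB cfThirteenDB naNine nbNine pUpperNineB; ring

end PercRepro
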